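import Summits.BirchSwinnertonDyer.BirchSwinnertonDyer.Theorems.GenusKolyvaginAtTwoHeegnerValuationLedger
import Summits.BirchSwinnertonDyer.BirchSwinnertonDyer.Theorems.GenusKolyvaginAtTwoShaConsistencyLawFreeCells
import HarnessLib

/-!
# Route `GenusKolyvaginAtTwo`, crux K₄⁺ `K4Pos` (stmt-BirchSwinnertonDyer-31469), LINE 29 «frame_rigidity»: stub F2L `stub_twoFrameLedger` IS A THEOREM

LEAD seat `bsd-line-gk2-p1` g26 (cell `bsd-f1-sign2`), `--supports stmt-BirchSwinnertonDyer-31469`.  THEOREMS ONLY (no definition, no named fact,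
no `sorry`).  **BSD is NOT proved by this file; K4Pos is NOT proved; no item is closed.**  CONDITIONAL on the route's four PRINT items
(`GrossZagierAllLevels`, `MultPublishedInputsAtTwo`, `EntireLFunctionRat`, `MilneAnyModel`), displayed as binders exactly as in the stub.

* `k4Pos_frameLedger_eq` — ONE frame: on the K₄⁺ cell (`Δ > 0`, real-narrow `#Sel₂(E) = 4`, admissible prime frame `K = ℚ(√−ℓ₀)` with `2` split,
  odd-Manin `Dt`, `2^(M₀) ∥ P(1)`, shallow `Sel₂`-minimal rank-one twin `Wd`): `#Ш_an(E) = qW ∈ ℚ` and **`2·M₀ = ord₂ qW + ord₂ qd`** for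
  `#Ш_an(Wd) = qd` — the Heegner valuation ledger `ValuationLedger.two_mul_depth_eq_padicValRat_add` with `Ш(Wd/ℚ)[2^∞] = 0` (rank one, `#Sel₂ = 2`)
  and gk2-p4 g29's cell law `ShaCores.natCard_shaPrimary_baseChange_eq_rat_of_kFourPos_cell` (`#Ш(E_K/K)[2^∞] = #Ш(E/ℚ)[2^∞]`; its count binders
  `rank E(ℚ) = 0`, `Ш(E/ℚ)`, `Ш(E_K/K)` finite are GZK + Gross–Zagier over `K`).  NO multiplicative prime, NO Q2, NO `M₀ ≥ 1` needed.
* `k4Pos_twoFrameLedger` — **LINE 29 stub F2L `stub_twoFrameLedger` VERBATIM** (two frames: `2·M₀ − 2·M₁ = (ord₂ q₀ + ord₂ C(Wd₀)) − (ord₂ q₁ +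
  ord₂ C(Wd₁))`; here `ord₂ C(Wd_i) = 0` by the shallow clause and `ord₂ qW` cancels); pen: plug `stub_twoFrameLedger := …ValuationLedger.k4Pos_twoFrameLedger`.
READING: with F2L a theorem, LINE 29's open content is F1 (frame attainment = the rank-0 wall), F2T (twin-to-twin unit-layer transport), F2Z (unit-twin
supply) and F4 (off-cut) — unchanged; the single-frame form says `M₀` is determined by `ord₂ #Ш_an(Wd)` ALONE once `E` is fixed (`2M₀ = ord₂ #Ш_an(E) +
ord₂ #Ш_an(Wd)`), i.e. F2 «depth rigidity» ⟺ «`ord₂ #Ш_an(E^(−ℓ))` is constant over the cell's admissible `ℓ`» EXACTLY (the card's F2⁺), mod PRINT.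

References: [GrossZagier1986] V §2 (2.2); [Milne1972ArithmeticAV] §1 Thm. 1; [Kramer1981] Thm. 1, Prop. 7; [Miller2011LMS] Def. 1.1; [SilvermanAEC2009] Thm. X.4.2.
-/

set_option autoImplicit false
set_option linter.dupNamespace false -- `Summit.<P>.<Sub>` repeats `BirchSwinnertonDyer` (D-0017)

noncomputable section

open scoped Classical

namespace Summit.BirchSwinnertonDyer.BirchSwinnertonDyer.Theorems.GenusExact.ValuationLedger

open WeierstrassCurve NumberField IsDedekindDomain Field Literature.NumberTheory.EllipticCurves
  Literature.NumberTheory.GaloisRepresentations Literature.NumberTheory.EllipticCurves.ModularForms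
  Literature.NumberTheory.EllipticCurves.RingClassField
  Summit.BirchSwinnertonDyer.BirchSwinnertonDyer.Theses.GenusKolyvaginAtTwo

/-- **THE K₄⁺ FRAME LEDGER (one frame)**: on the K₄⁺ cell with an admissible prime frame `K` (`2` split), odd-Manin `Dt`, `2^(M₀) ∥ P(1)` (any `M₀`),
the shallow `Sel₂`-minimal rank-one twin `Wd` and `#Ш_an(Wd) = qd ∈ ℚ`: `#Ш_an(E) = qW ∈ ℚ` and **`2·M₀ = ord₂ qW + ord₂ qd`**.  Heegner valuation ledger +
`Ш(Wd)[2^∞] = 0` + the K₄⁺ cell law `#Ш(E_K)[2^∞] = #Ш(E/ℚ)[2^∞]`.  CONDITIONAL on the four print items; BSD / K4Pos NOT proved.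
[cite: GrossZagier1986, V §2 (2.2)] [cite: Milne1972ArithmeticAV, §1 Thm. 1] [cite: Kramer1981, Thm. 1, Prop. 7] [cite: Miller2011LMS, Def. 1.1] -/
theorem k4Pos_frameLedger_eq (hGZ : GrossZagierAllLevels) (hGZK : MultPublishedInputsAtTwo) (hL : EntireLFunctionRat) (hMi : MilneAnyModel)
    (W : WeierstrassCurve ℚ) [W.IsElliptic] [W.IsGloballyMinimal] [NeZero (W.conductorNorm ℤ)]
    (hr0 : W.analyticRank = 0) (hρ : ∀ n : ℕ, 0 < n → W.HasSurjectiveModNGaloisRep ((2 : ℤ) ^ n))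
    (hT : Odd W.tamagawaProduct) (hpos : 0 < W.Δ)
    (h4 : Nat.card (W.selmerGroup 2) = 4 ∧ ∃ c ∈ (W.kummerSelmerStructure ((2 : ℕ) : ℤ)).selmerGroup,
      galoisCohomology.localization (W.torsionGaloisModule ((2 : ℕ) : ℤ)) (Sum.inl Rat.infinitePlace) 1 c ≠ 0)
    (Dt : ModularParametrizationData W (W.conductorNorm ℤ)) (hc : Odd Dt.c)
    (K : Type) [Field K] [NumberField K] (hIQ : IsImaginaryQuadratic K) (hodd : Odd (NumberField.discr K))
    (h3 : NumberField.discr K ≠ -3) (hHe : SatisfiesHeegnerHypothesis (W.conductorNorm ℤ) K)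
    (h2K : ((Ideal.span {(2 : ℤ)}).primesOver (𝓞 K)).ncard = 2)
    (β : ℤ) (ι : K →+* ℂ) (d₁ : KolyvaginHeegnerData Dt β ι 1) (hy : ¬ IsOfFinAddOrder d₁.derivedPoint)
    {M₀ : ℕ} (hdiv : ∃ Q : (W.baseChange (ringClassField K ι 1)).toAffine.Point, ((2 ^ M₀ : ℕ) : ℤ) • Q = d₁.derivedPoint)
    (hndiv : ¬ ∃ Q : (W.baseChange (ringClassField K ι 1)).toAffine.Point, ((2 ^ (M₀ + 1) : ℕ) : ℤ) • Q = d₁.derivedPoint)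
    (Wd : WeierstrassCurve ℚ) [Wd.IsElliptic] [Wd.IsGloballyMinimal]
    (hWd : ∃ C : VariableChange ℚ, C • W.quadraticTwist (NumberField.discr K : ℚ) = Wd)
    (hrd : Wd.analyticRank = 1) (hSel : Nat.card (Wd.selmerGroup 2) = 2) (hDEF : padicValNat 2 Wd.tamagawaProduct = 0)
    {qd : ℚ} (hqd : shaAn Wd = (qd : ℂ)) :
    ∃ qW : ℚ, shaAn W = (qW : ℂ) ∧ 2 * (M₀ : ℤ) = padicValRat 2 qW + padicValRat 2 qd := by
  haveI : Fact (Nat.Prime 2) := ⟨Nat.prime_two⟩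
  have hρ2 : W.HasSurjectiveModNGaloisRep 2 := by simpa using hρ 1 one_pos
  have hrk0 : W.mordellWeilRank = 0 := (hGZK W (by rw [hr0]; exact zero_le_one)).1.trans hr0
  have hsq : ¬ IsSquare ((NumberField.discr K : ℚ) * W.Δ) := by
    rintro ⟨r, hr⟩
    have hneg : (NumberField.discr K : ℚ) * W.Δ < 0 :=
      mul_neg_of_neg_of_pos (by exact_mod_cast IsImaginaryQuadratic.discr_neg hIQ) hpos
    rw [hr] at hneg
    exact absurd hneg (not_lt.mpr (mul_self_nonneg r))
  obtain ⟨σ₀, hσ₀, -⟩ := exists_conj_of_isImaginaryQuadratic (K := K) hIQ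
  obtain ⟨Cd, hCd⟩ := hWd
  have hrk : Wd.mordellWeilRank = 1 := (hGZK Wd (by rw [hrd])).1.trans hrd
  exact exists_two_mul_depth_eq_padicValRat_add hGZ hGZK hL hMi W hρ2 hT hr0 K hIQ hodd h3 hHe Dt hc β ι d₁ hdiv hndiv Wd ⟨Cd, hCd⟩ hrd hqd
    (natCard_primaryComponent_sha_two_eq_one_of_rank_one Wd hrk hSel)
    (by
      intro _ _
      exact (ShaCores.natCard_shaPrimary_baseChange_eq_rat_of_kFourPos_cell W K hpos hρ2 hT h4 hIQ hodd hHe h2K hσ₀ Cd hCd hDEF hSel hr0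
        hsq Dt β ι d₁ hy hdiv hndiv hrk0).1)

/-- **LINE 29 «frame_rigidity» STUB F2L `stub_twoFrameLedger` — VERBATIM** (pen bsd-idea-1 g26, `Cruxes/K4Pos/Lines/frame_rigidity.lean` v1.2): for
`E = W` on the K₄⁺ cell with an odd-Manin `Dt` and TWO admissible prime frames with Heegner data (exact depths `M₀`, `M₁ ≥ 1`) and their shallow
`Sel₂`-minimal rank-one twins `Wd₀`, `Wd₁` with `#Ш_an(Wd_i) = q_i ∈ ℚ`:
**`2·M₀ − 2·M₁ = (ord₂ q₀ + ord₂ C(Wd₀)) − (ord₂ q₁ + ord₂ C(Wd₁))`** — `k4Pos_frameLedger_eq` at both frames (the common `ord₂ #Ш_an(E)` cancels;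
`ord₂ C(Wd_i) = 0`).  Pen: plug by name.  CONDITIONAL on the four print items; BSD / K4Pos NOT proved — the line's open content is F1 / F2T / F2Z / F4.
[cite: GrossZagier1986, V §2 (2.2)] [cite: Milne1972ArithmeticAV, §1 Thm. 1] [cite: Kramer1981, Thm. 1, Prop. 7] [cite: Miller2011LMS, Def. 1.1] -/
theorem k4Pos_twoFrameLedger (hGZ : GrossZagierAllLevels) (hGZK : MultPublishedInputsAtTwo) (hL : EntireLFunctionRat) (hMi : MilneAnyModel)
    (W : WeierstrassCurve ℚ) [W.IsElliptic] [W.IsGloballyMinimal] [NeZero (W.conductorNorm ℤ)]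
    (_hcm : ¬ W.HasCM) (hr0 : W.analyticRank = 0) (hρ : ∀ n : ℕ, 0 < n → W.HasSurjectiveModNGaloisRep ((2 : ℤ) ^ n))
    (hT : Odd W.tamagawaProduct) (hpos : 0 < W.Δ)
    (h4 : Nat.card (W.selmerGroup 2) = 4 ∧ ∃ c ∈ (W.kummerSelmerStructure ((2 : ℕ) : ℤ)).selmerGroup,
      galoisCohomology.localization (W.torsionGaloisModule ((2 : ℕ) : ℤ)) (Sum.inl Rat.infinitePlace) 1 c ≠ 0)
    (Dt : ModularParametrizationData W (W.conductorNorm ℤ))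
    (_hopt : ∀ z ∈ Dt.L.lattice, ∃ w ∈ periodLattice Dt.f, z = (Dt.c : ℂ) * w) (hc : Odd Dt.c)
    (K₀ : Type) [Field K₀] [NumberField K₀] (hIQ₀ : IsImaginaryQuadratic K₀) (hodd₀ : Odd (NumberField.discr K₀))
    (h3₀ : NumberField.discr K₀ ≠ -3) (hHe₀ : SatisfiesHeegnerHypothesis (W.conductorNorm ℤ) K₀)
    (_hsq1₀ : ¬ IsSquare ((NumberField.discr K₀ : ℚ) * -|W.Δ|)) (_hsq2₀ : ¬ IsSquare ((NumberField.discr K₀ : ℚ) * (-(2 * |W.Δ|))))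
    (ℓ₀ : ℕ) (_hℓ₀ : ℓ₀.Prime) (_hdK₀ : NumberField.discr K₀ = -(ℓ₀ : ℤ))
    (h2K₀ : ((Ideal.span {(2 : ℤ)}).primesOver (𝓞 K₀)).ncard = 2)
    (β₀ : ℤ) (ι₀ : K₀ →+* ℂ) (d₀ : KolyvaginHeegnerData Dt β₀ ι₀ 1) (hy₀ : ¬ IsOfFinAddOrder d₀.derivedPoint)
    (M₀ : ℕ) (hdiv₀ : ∃ Q : (W.baseChange (ringClassField K₀ ι₀ 1)).toAffine.Point, ((2 ^ M₀ : ℕ) : ℤ) • Q = d₀.derivedPoint)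
    (hndiv₀ : ¬ ∃ Q : (W.baseChange (ringClassField K₀ ι₀ 1)).toAffine.Point, ((2 ^ (M₀ + 1) : ℕ) : ℤ) • Q = d₀.derivedPoint)
    (_hM₀ : 1 ≤ M₀)
    (Wd₀ : WeierstrassCurve ℚ) [Wd₀.IsElliptic] [Wd₀.IsGloballyMinimal]
    (hWd₀ : ∃ C : VariableChange ℚ, C • W.quadraticTwist (NumberField.discr K₀ : ℚ) = Wd₀)
    (hrd₀ : Wd₀.analyticRank = 1) (hSel₀ : Nat.card (Wd₀.selmerGroup 2) = 2) (hDEF₀ : padicValNat 2 Wd₀.tamagawaProduct = 0)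
    (K₁ : Type) [Field K₁] [NumberField K₁] (hIQ₁ : IsImaginaryQuadratic K₁) (hodd₁ : Odd (NumberField.discr K₁))
    (h3₁ : NumberField.discr K₁ ≠ -3) (hHe₁ : SatisfiesHeegnerHypothesis (W.conductorNorm ℤ) K₁)
    (_hsq1₁ : ¬ IsSquare ((NumberField.discr K₁ : ℚ) * -|W.Δ|)) (_hsq2₁ : ¬ IsSquare ((NumberField.discr K₁ : ℚ) * (-(2 * |W.Δ|))))
    (ℓ₁ : ℕ) (_hℓ₁ : ℓ₁.Prime) (_hdK₁ : NumberField.discr K₁ = -(ℓ₁ : ℤ))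
    (h2K₁ : ((Ideal.span {(2 : ℤ)}).primesOver (𝓞 K₁)).ncard = 2)
    (β₁ : ℤ) (ι₁ : K₁ →+* ℂ) (d₁ : KolyvaginHeegnerData Dt β₁ ι₁ 1) (hy₁ : ¬ IsOfFinAddOrder d₁.derivedPoint)
    (M₁ : ℕ) (hdiv₁ : ∃ Q : (W.baseChange (ringClassField K₁ ι₁ 1)).toAffine.Point, ((2 ^ M₁ : ℕ) : ℤ) • Q = d₁.derivedPoint)
    (hndiv₁ : ¬ ∃ Q : (W.baseChange (ringClassField K₁ ι₁ 1)).toAffine.Point, ((2 ^ (M₁ + 1) : ℕ) : ℤ) • Q = d₁.derivedPoint)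
    (_hM₁ : 1 ≤ M₁)
    (Wd₁ : WeierstrassCurve ℚ) [Wd₁.IsElliptic] [Wd₁.IsGloballyMinimal]
    (hWd₁ : ∃ C : VariableChange ℚ, C • W.quadraticTwist (NumberField.discr K₁ : ℚ) = Wd₁)
    (hrd₁ : Wd₁.analyticRank = 1) (hSel₁ : Nat.card (Wd₁.selmerGroup 2) = 2) (hDEF₁ : padicValNat 2 Wd₁.tamagawaProduct = 0)
    (q₀ q₁ : ℚ) (hq₀ : shaAn Wd₀ = (q₀ : ℂ)) (hq₁ : shaAn Wd₁ = (q₁ : ℂ)) :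
    2 * (M₀ : ℤ) - 2 * (M₁ : ℤ) =
      (padicValRat 2 q₀ + (padicValNat 2 Wd₀.tamagawaProduct : ℤ)) - (padicValRat 2 q₁ + (padicValNat 2 Wd₁.tamagawaProduct : ℤ)) := by
  obtain ⟨qW, hqW, h₀⟩ := k4Pos_frameLedger_eq hGZ hGZK hL hMi W hr0 hρ hT hpos h4 Dt hc K₀ hIQ₀ hodd₀ h3₀ hHe₀ h2K₀ β₀ ι₀ d₀ hy₀ hdiv₀
    hndiv₀ Wd₀ hWd₀ hrd₀ hSel₀ hDEF₀ hq₀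
  obtain ⟨qW', hqW', h₁⟩ := k4Pos_frameLedger_eq hGZ hGZK hL hMi W hr0 hρ hT hpos h4 Dt hc K₁ hIQ₁ hodd₁ h3₁ hHe₁ h2K₁ β₁ ι₁ d₁ hy₁ hdiv₁
    hndiv₁ Wd₁ hWd₁ hrd₁ hSel₁ hDEF₁ hq₁
  have hqq : qW' = qW := Rat.cast_injective (α := ℂ) (hqW'.symm.trans hqW)
  rw [hqq] at h₁
  rw [hDEF₀, hDEF₁]
  push_cast
  linarith

end Summit.BirchSwinnertonDyer.BirchSwinnertonDyer.Theorems.GenusExact.ValuationLedger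

end
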